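import Literature.Barriers.QuantumAdvantage.NoFreeFrameCubeAlmostBent
import HarnessLib

/-!
# `cubeAlmostBent` holds: the Gold/Nyberg cube map `x ↦ x³` on `𝔽_{2ⁿ}` is APN and near-bent

Barrier catalogue `Literature/Barriers/QuantumAdvantage/` (D-0021). Proofs only (no definitions, no
named facts): the discharge of the named fact `Literature.Barriers.QuantumAdvantage.cubeAlmostBent` of
`NoFreeFrameCubeAlmostBent.lean`. For every finite field `K` of order `2ⁿ` (a `ZMod 2`-algebra):

* (i) `x ↦ x³` is almost perfect nonlinear: for `a ≠ 0` the equation `(x + a)³ + x³ = b` reads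
  `a·x² + a²·x + a³ = b` in characteristic 2, a nonzero quadratic in `x`, so it has at most two
  solutions (`card_le_two_of_cube_diff`);
* (ii) the component functions `x ↦ Tr(αx + βx³)`, `β ≠ 0`, are near-bent:
  `|Σ_x (−1)^{Tr(αx + βx³)}| ≤ 2·√2ⁿ` (`abs_walsh_cube_le`). Squaring the Walsh sum and substituting
  `y = x + u`, the inner sum over `x` is the character sum of `x ↦ Tr(βu·x² + βu²·x)`; by Frobenius
  invariance of the trace (`trace_sq`) this is `Tr((βu + β²u⁴)·x²)`, and since Frobenius is a
  bijection and the trace form is non-degenerate the inner sum is `|K|·[βu + β²u⁴ = 0]`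
  (`sum_e_mul_eq_zero`). The quartic `β²u⁴ + βu` has at most four roots
  (`card_le_four_of_quartic`), so `W² ≤ 4·|K| = (2·√2ⁿ)²`.

PROVENANCE. The barrier docstring of `cubeAlmostBent` records that this statement was machine-checked
in the tree as `Summit.QuantumAdvantage.QuantumAdvantage.Theorems.SymplecticPurity.cubeAlmostBent_proof`
(item stmt-QuantumAdvantage-9841 of the retired route `SymplecticPurity`), with a body definitionally
equal to the Literature `def`; `Literature` cannot import `Summits`, so the Mathlib-only proof of
`Summits/QuantumAdvantage/QuantumAdvantage/Theorems/SymplecticPurityCubeAlmostBent.lean` is carried over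
here verbatim (as private helper lemmas in the sub-namespace `…QuantumAdvantage.CubeAlmostBent`) and closed as
`cubeAlmostBent_holds`. Everything is proved from Mathlib (`traceForm_nondegenerate`,
`Algebra.trace_eq_of_algEquiv`, `FiniteField.frobeniusAlgEquivOfAlgebraic`, `Polynomial.card_roots'`).

## References

* [Gold1968] R. Gold, *Maximal recursive sequences with 3-valued recursive cross-correlation functions*,
  IEEE Trans. Inform. Theory 14 (1968), 154–156.
* [Nyberg1994] K. Nyberg, *Differentially uniform mappings for cryptography*, EUROCRYPT '93, LNCS 765
  (1994), 55–64.
* [Carlet2020] C. Carlet, *Boolean Functions for Cryptography and Coding Theory*, Cambridge University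
  Press (2020/2021): §11.5.2 (PDF p. 497, Gold APN functions) and PDF pp. 222–223.
-/

namespace Literature.Barriers.QuantumAdvantage

open Finset Polynomial

namespace CubeAlmostBent

/-! ### The real character `t ↦ (−1)ᵗ` of `ZMod 2` -/

/-- Multiplicativity of the sign character of `ZMod 2`: `(−1)^{s+t} = (−1)^s (−1)^t`. [folklore] -/
private theorem chi_add (s t : ZMod 2) :
    (if s + t = 0 then (1 : ℝ) else -1) =
      (if s = 0 then (1 : ℝ) else -1) * (if t = 0 then 1 else -1) := by
  have key : ∀ r : ZMod 2, r = 0 ∨ r = 1 := by decide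
  have h11 : (1 : ZMod 2) + 1 = 0 := by decide
  have h10 : (1 : ZMod 2) ≠ 0 := by decide
  rcases key s with rfl | rfl <;> rcases key t with rfl | rfl <;> simp [h11, h10]

/-- The sign character of `ZMod 2` takes values of absolute value at most one. [folklore] -/
private theorem abs_chi_le (t : ZMod 2) : |(if t = 0 then (1 : ℝ) else -1)| ≤ 1 := by
  split_ifs <;> simp

/-! ### Characteristic-2 polynomial identities and root counts -/

section CharTwoFacts

variable {K : Type*} [Field K]

/-- In characteristic 2, `(x + a)³ + x³ = a·x² + a²·x + a³`. [folklore] -/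
private theorem cube_add_cube_eq [CharP K 2] (x a : K) :
    (x + a) ^ 3 + x ^ 3 = a * x ^ 2 + a ^ 2 * x + a ^ 3 := by
  have h2 : (2 : K) = 0 := CharTwo.two_eq_zero
  linear_combination (x ^ 3 + a * x ^ 2 + a ^ 2 * x) * h2

/-- In characteristic 2, the derivative of `x ↦ α·x + β·x³` in direction `u`:
`(α x + β x³) + (α (x+u) + β (x+u)³) = (α u + β u³) + (β u·x² + β u²·x)`.
[folklore] -/
private theorem cube_derivative_eq [CharP K 2] (α β x u : K) :
    (α * x + β * x ^ 3) + (α * (x + u) + β * (x + u) ^ 3) =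
      (α * u + β * u ^ 3) + (β * u * x ^ 2 + β * u ^ 2 * x) := by
  have h2 : (2 : K) = 0 := CharTwo.two_eq_zero
  linear_combination (α * x + β * x ^ 3 + β * x ^ 2 * u + β * x * u ^ 2) * h2

/-- (i, APN) A finite set of solutions of `(x + a)³ + x³ = b` with `a ≠ 0` has at most two elements:
in characteristic 2 the equation is the nonzero quadratic `a·x² + a²·x + (a³ − b) = 0`.
[folklore] -/
private theorem card_le_two_of_cube_diff [CharP K 2] (a : K) (ha : a ≠ 0) (b : K) (s : Finset K)
    (hs : ∀ x ∈ s, (x + a) ^ 3 + x ^ 3 = b) : s.card ≤ 2 := by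
  classical
  set p : K[X] := C a * X ^ 2 + C (a ^ 2) * X + C (a ^ 3 - b) with hp
  have hp0 : p ≠ 0 := by
    intro h
    have h2 := congrArg (fun q : K[X] => q.coeff 2) h
    simp only [hp, coeff_add, coeff_C_mul, coeff_X_pow, coeff_X, coeff_C, coeff_zero] at h2
    norm_num at h2
    exact ha h2
  calc s.card ≤ p.roots.toFinset.card := by
        refine Finset.card_le_card fun x hx => ?_
        rw [Multiset.mem_toFinset, mem_roots hp0, IsRoot.def, hp]
        simp only [eval_add, eval_mul, eval_C, eval_pow, eval_X]
        rw [← hs x hx, cube_add_cube_eq]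
        ring
    _ ≤ Multiset.card p.roots := Multiset.toFinset_card_le _
    _ ≤ p.natDegree := card_roots' p
    _ ≤ 2 := natDegree_quadratic_le

/-- A finite set of roots of `β·u + β²·u⁴` with `β ≠ 0` has at most four elements. [folklore] -/
private theorem card_le_four_of_quartic (β : K) (hβ : β ≠ 0) (s : Finset K)
    (hs : ∀ u ∈ s, β * u + β ^ 2 * u ^ 4 = 0) : s.card ≤ 4 := by
  classical
  set p : K[X] := C (β ^ 2) * X ^ 4 + C β * X with hp
  have hp0 : p ≠ 0 := by
    intro h
    have h4 := congrArg (fun q : K[X] => q.coeff 4) h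
    simp only [hp, coeff_add, coeff_C_mul, coeff_X_pow, coeff_X, coeff_zero] at h4
    norm_num at h4
    exact hβ h4
  have hdeg : p.natDegree ≤ 4 := by
    rw [hp]
    compute_degree
  calc s.card ≤ p.roots.toFinset.card := by
        refine Finset.card_le_card fun u hu => ?_
        rw [Multiset.mem_toFinset, mem_roots hp0, IsRoot.def, hp]
        simp only [eval_add, eval_mul, eval_C, eval_pow, eval_X]
        rw [← hs u hu]
        ring
    _ ≤ Multiset.card p.roots := Multiset.toFinset_card_le _
    _ ≤ p.natDegree := card_roots' p
    _ ≤ 4 := hdeg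

end CharTwoFacts

/-! ### Trace and character sums over a finite field of characteristic 2

To keep statements short, the lemmas below are stated for an arbitrary function `e : K → ℝ`
together with the hypothesis `he : ∀ z, e z = if Algebra.trace (ZMod 2) K z = 0 then 1 else -1`
(i.e. `e z = (−1)^{Tr z}`); the closing theorem instantiates `e` with that very function. -/

section Trace

variable {K : Type*} [Field K] [Algebra (ZMod 2) K]

/-- A field that is a `ZMod 2`-algebra has characteristic 2. [folklore] -/
private theorem charP_two_of_algebra : CharP K 2 :=
  charP_of_injective_algebraMap (algebraMap (ZMod 2) K).injective 2

/-- `e z = (−1)^{Tr z}` is multiplicative along sums: `e (z + w) = e z * e w`. [folklore] -/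
private theorem e_add {e : K → ℝ}
    (he : ∀ z, e z = if Algebra.trace (ZMod 2) K z = 0 then (1 : ℝ) else -1) (z w : K) :
    e (z + w) = e z * e w := by
  rw [he, he, he, map_add, chi_add]

/-- `|e z| ≤ 1` for `e z = (−1)^{Tr z}`. [folklore] -/
private theorem abs_e_le {e : K → ℝ}
    (he : ∀ z, e z = if Algebra.trace (ZMod 2) K z = 0 then (1 : ℝ) else -1) (z : K) :
    |e z| ≤ 1 := by
  rw [he]
  exact abs_chi_le _

/-- Pointwise identity behind the substitution `y = x + u` in the squared Walsh sum:
`(−1)^{Tr(f x)} (−1)^{Tr(f (x+u))} = (−1)^{Tr(αu + βu³)} (−1)^{Tr(βu x² + βu² x)}` for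
`f x = αx + βx³` (characteristic 2).
[folklore] -/
private theorem e_mul_e_shift {e : K → ℝ}
    (he : ∀ z, e z = if Algebra.trace (ZMod 2) K z = 0 then (1 : ℝ) else -1) (α β x u : K) :
    e (α * x + β * x ^ 3) * e (α * (x + u) + β * (x + u) ^ 3) =
      e (α * u + β * u ^ 3) * e (β * u * x ^ 2 + β * u ^ 2 * x) := by
  haveI : CharP K 2 := charP_two_of_algebra
  rw [← e_add he, ← e_add he, cube_derivative_eq]

variable [Fintype K]

/-- Frobenius invariance of the absolute trace: `Tr(x²) = Tr(x)` (Frobenius is a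
`ZMod 2`-algebra automorphism, and the trace is invariant under algebra automorphisms).
[folklore] -/
private theorem trace_sq (x : K) : Algebra.trace (ZMod 2) K (x ^ 2) = Algebra.trace (ZMod 2) K x := by
  have h := Algebra.trace_eq_of_algEquiv (FiniteField.frobeniusAlgEquivOfAlgebraic (ZMod 2) K) x
  simp only [FiniteField.coe_frobeniusAlgEquivOfAlgebraic, ZMod.card] at h
  exact h

/-- Orthogonality of characters, trivial case: `Σ_x (−1)^{Tr(0·x)} = |K|`. [folklore] -/
private theorem sum_e_zero_mul {e : K → ℝ}
    (he : ∀ z, e z = if Algebra.trace (ZMod 2) K z = 0 then (1 : ℝ) else -1) :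
    ∑ x : K, e (0 * x) = (Fintype.card K : ℝ) := by
  simp [he]

/-- Orthogonality of characters: for `c ≠ 0`, `Σ_x (−1)^{Tr(c·x)} = 0`, because the trace form of
the separable extension `K / ZMod 2` is non-degenerate (`traceForm_nondegenerate`), so
`x ↦ Tr(c·x)` is a nontrivial additive character.
[folklore] -/
private theorem sum_e_mul_eq_zero {e : K → ℝ}
    (he : ∀ z, e z = if Algebra.trace (ZMod 2) K z = 0 then (1 : ℝ) else -1) {c : K} (hc : c ≠ 0) :
    ∑ x : K, e (c * x) = 0 := by
  obtain ⟨y, hy⟩ : ∃ y : K, Algebra.trace (ZMod 2) K (c * y) ≠ 0 := by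
    have htr := (traceForm_nondegenerate (ZMod 2) K).1 c
    simp_rw [Algebra.traceForm_apply] at htr
    by_contra! hf
    exact hc (htr hf)
  have hey : e (c * y) = -1 := by rw [he, if_neg hy]
  set S := ∑ x : K, e (c * x) with hS
  have h1 : S = e (c * y) * S := by
    calc S = ∑ x : K, e (c * (y + x)) := by
          rw [hS]
          exact (Equiv.sum_comp (Equiv.addLeft y) (fun x => e (c * x))).symm
      _ = ∑ x : K, e (c * y) * e (c * x) := by
          refine Finset.sum_congr rfl fun x _ => ?_
          rw [mul_add, e_add he]
      _ = e (c * y) * S := by rw [hS, Finset.mul_sum]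
  rw [hey] at h1
  linarith

/-- Squaring the Walsh sum of `x ↦ Tr(αx + βx³)` and substituting `y = x + u`:
`W² = Σ_u (−1)^{Tr(αu + βu³)} · Σ_x (−1)^{Tr(βu x² + βu² x)}`.
[folklore] -/
private theorem walsh_sq_eq {e : K → ℝ}
    (he : ∀ z, e z = if Algebra.trace (ZMod 2) K z = 0 then (1 : ℝ) else -1) (α β : K) :
    (∑ x : K, e (α * x + β * x ^ 3)) ^ 2 =
      ∑ u : K, e (α * u + β * u ^ 3) * ∑ x : K, e (β * u * x ^ 2 + β * u ^ 2 * x) := by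
  rw [sq, Fintype.sum_mul_sum]
  calc ∑ x : K, ∑ y : K, e (α * x + β * x ^ 3) * e (α * y + β * y ^ 3)
      = ∑ x : K, ∑ u : K, e (α * u + β * u ^ 3) * e (β * u * x ^ 2 + β * u ^ 2 * x) := by
        refine Finset.sum_congr rfl fun x _ => ?_
        refine (Fintype.sum_equiv (Equiv.addLeft x) _ _ fun u => ?_).symm
        exact (e_mul_e_shift he α β x u).symm
    _ = ∑ u : K, ∑ x : K, e (α * u + β * u ^ 3) * e (β * u * x ^ 2 + β * u ^ 2 * x) :=
        Finset.sum_comm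
    _ = ∑ u : K, e (α * u + β * u ^ 3) * ∑ x : K, e (β * u * x ^ 2 + β * u ^ 2 * x) :=
        Finset.sum_congr rfl fun u _ => (Finset.mul_sum _ _ _).symm

/-- The inner sum is a linear character sum: by `Tr(z) = Tr(z²)` applied to `z = βu²·x`,
`Tr(βu·x² + βu²·x) = Tr((βu + β²u⁴)·x²)`, and `x ↦ x²` is a bijection of `K`.
[folklore] -/
private theorem inner_sum_eq {e : K → ℝ}
    (he : ∀ z, e z = if Algebra.trace (ZMod 2) K z = 0 then (1 : ℝ) else -1) (β u : K) :
    ∑ x : K, e (β * u * x ^ 2 + β * u ^ 2 * x) = ∑ y : K, e ((β * u + β ^ 2 * u ^ 4) * y) := by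
  haveI : CharP K 2 := charP_two_of_algebra
  have h1 : ∀ x : K, e (β * u * x ^ 2 + β * u ^ 2 * x) = e ((β * u + β ^ 2 * u ^ 4) * x ^ 2) := by
    intro x
    have ht : Algebra.trace (ZMod 2) K (β * u * x ^ 2 + β * u ^ 2 * x) =
        Algebra.trace (ZMod 2) K ((β * u + β ^ 2 * u ^ 4) * x ^ 2) := by
      rw [map_add, ← trace_sq (β * u ^ 2 * x), ← map_add]
      congr 1
      ring
    rw [he, he, ht]
  simp_rw [h1]
  exact (Finite.injective_iff_bijective.mp (CharTwo.sq_injective (R := K))).sum_comp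
    (fun y => e ((β * u + β ^ 2 * u ^ 4) * y))

/-- (ii, near-bent, abstract form) For `|K| = 2ⁿ`, `β ≠ 0` and any `α`:
`|Σ_x (−1)^{Tr(αx + βx³)}| ≤ 2·√2ⁿ`.
[folklore] -/
private theorem abs_walsh_le {e : K → ℝ}
    (he : ∀ z, e z = if Algebra.trace (ZMod 2) K z = 0 then (1 : ℝ) else -1)
    {n : ℕ} (hK : Fintype.card K = 2 ^ n) {β : K} (hβ : β ≠ 0) (α : K) :
    |∑ x : K, e (α * x + β * x ^ 3)| ≤ 2 * Real.sqrt 2 ^ n := by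
  classical
  set W := ∑ x : K, e (α * x + β * x ^ 3) with hW
  have hN : (Fintype.card K : ℝ) = 2 ^ n := by exact_mod_cast hK
  have hterm : ∀ u : K,
      |e (α * u + β * u ^ 3) * ∑ x : K, e (β * u * x ^ 2 + β * u ^ 2 * x)| ≤
        if β * u + β ^ 2 * u ^ 4 = 0 then (Fintype.card K : ℝ) else 0 := by
    intro u
    rw [inner_sum_eq he, abs_mul]
    by_cases hu : β * u + β ^ 2 * u ^ 4 = 0
    · rw [if_pos hu, hu, sum_e_zero_mul he, Nat.abs_cast]
      calc |e (α * u + β * u ^ 3)| * (Fintype.card K : ℝ) ≤ 1 * (Fintype.card K : ℝ) :=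
            mul_le_mul_of_nonneg_right (abs_e_le he _) (Nat.cast_nonneg _)
        _ = (Fintype.card K : ℝ) := one_mul _
    · rw [if_neg hu, sum_e_mul_eq_zero he hu, abs_zero, mul_zero]
  have hW2 : W ^ 2 ≤ 4 * (Fintype.card K : ℝ) := by
    calc W ^ 2 = |W ^ 2| := (abs_of_nonneg (sq_nonneg W)).symm
      _ = |∑ u : K, e (α * u + β * u ^ 3) * ∑ x : K, e (β * u * x ^ 2 + β * u ^ 2 * x)| := by
          rw [hW, walsh_sq_eq he]
      _ ≤ ∑ u : K, |e (α * u + β * u ^ 3) * ∑ x : K, e (β * u * x ^ 2 + β * u ^ 2 * x)| :=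
          Finset.abs_sum_le_sum_abs _ _
      _ ≤ ∑ u : K, (if β * u + β ^ 2 * u ^ 4 = 0 then (Fintype.card K : ℝ) else 0) :=
          Finset.sum_le_sum fun u _ => hterm u
      _ = ((Finset.univ.filter fun u : K => β * u + β ^ 2 * u ^ 4 = 0).card : ℝ) *
            (Fintype.card K : ℝ) := by
          rw [← Finset.sum_filter, Finset.sum_const, nsmul_eq_mul]
      _ ≤ 4 * (Fintype.card K : ℝ) := by
          gcongr
          exact_mod_cast card_le_four_of_quartic β hβ _ fun u hu => (Finset.mem_filter.mp hu).2
  have hsq : (2 * Real.sqrt 2 ^ n) ^ 2 = 4 * (Fintype.card K : ℝ) := by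
    rw [hN, mul_pow, ← pow_mul, mul_comm n 2, pow_mul, Real.sq_sqrt (by norm_num : (0 : ℝ) ≤ 2)]
    norm_num
  refine abs_le_of_sq_le_sq ?_ (by positivity)
  rw [hsq]
  exact hW2

/-- (ii, near-bent) For `|K| = 2ⁿ`, `β ≠ 0` and any `α`: `|Σ_x (−1)^{Tr(αx + βx³)}| ≤ 2·√2ⁿ`. [folklore] -/
private theorem abs_walsh_cube_le {n : ℕ} (hK : Fintype.card K = 2 ^ n) {β : K} (hβ : β ≠ 0) (α : K) :
    |∑ x : K, (if Algebra.trace (ZMod 2) K (α * x + β * x ^ 3) = 0 then (1 : ℝ) else -1)| ≤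
      2 * Real.sqrt 2 ^ n :=
  abs_walsh_le (e := fun z => if Algebra.trace (ZMod 2) K z = 0 then (1 : ℝ) else -1)
    (fun _ => rfl) hK hβ α

end Trace

end CubeAlmostBent

/-! ### The named fact -/

/-- **`cubeAlmostBent` — DISCHARGED** (Gold 1968 / Nyberg 1993; Carlet 2020, §11.5.2): in every finite
field `K` of order `2ⁿ` (as a `ZMod 2`-algebra), (i) `x ↦ x³` is almost perfect nonlinear,
`#{x : (x+a)³ + x³ = b} ≤ 2` for `a ≠ 0`; (ii) its components are near-bent,
`|Σ_x (−1)^{Tr(αx + βx³)}| ≤ 2·√2ⁿ` for `β ≠ 0`.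
[cite: Carlet2020, §11.5.2 (PDF p. 497) and PDF pp. 222–223] [cite: Nyberg1994] [cite: Gold1968] -/
theorem cubeAlmostBent_holds : cubeAlmostBent := by
  unfold cubeAlmostBent
  intro n K _ _ _ hK
  classical
  haveI : CharP K 2 := CubeAlmostBent.charP_two_of_algebra
  refine ⟨fun a ha b => CubeAlmostBent.card_le_two_of_cube_diff a ha b _
      fun x hx => (Finset.mem_filter.mp hx).2,
    fun β hβ α => ?_⟩
  exact CubeAlmostBent.abs_walsh_cube_le hK hβ α

end Literature.Barriers.QuantumAdvantage
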